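import Summits.HodgeConjecture.CorCM.IrreducibleOddWeightsCanonicalPivot
import Summits.HodgeConjecture.CorCM.IrreducibleOddWeightsShadowIdealsSameField
import Literature.NumberTheory.NumberFields.ComplexAutomorphismsFixingIntersection
import HarnessLib

/-!
# Canonical pivot, II: two ARBITRARY CM fields — the exact defect `dim Hg(A₀) + dim Hg(A₁) − dim Hg(A₀ × A₁)` from the
# classes of embeddings of `K₀` agreeing on the TRACE `K₀ ∩ L₁` of the Galois closure of `K₁`; a totally real trace forces
# `Hg(A₀ × A₁) = Hg(A₀) × Hg(A₁)` whatever the types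

COR-CM (cell `pub-hodgecm2`, binder seat `b16` gen 65, count-neutral claim CANONICAL PIVOT, file C2 — CM fields and
realisations; theorems only, no definition, no named fact, no `sorry`).  NEW as stated, hence under `Summits/`.  HONEST
FRAMING: an exact, hypothesis-free formula for the codimension of the Hodge group of a product of two abelian varieties
with complex multiplication inside the product of their Hodge groups, and unconditional statements on which Hodge classes
on `A₀^a × A₁^b` are sums of products; no Hodge class is claimed algebraic beyond the tree's nondegenerate case; `HC_CM` is
neither used nor asserted.

SETTING.  CM fields `K_{i₀}`, `K_{i₁}` (`I = {i₀, i₁}`), CM types `Φ_κ`, `u_κ = 2·𝟙_{Φ_κ} − 1` on `Hom(K_κ, ℂ)`, realisations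
`A_κ ⊨ (K_κ; Φ_κ)`; `Aut(ℂ)` acts on the embeddings; `L₁ = normalClosure ℚ K_{i₁} ℂ` is the Galois closure of `K_{i₁}` IN
`ℂ`.  File C1 (`IrreducibleOddWeightsCanonicalPivot`) proved, for any `G`-sets, `dim Hg(A₀) + dim Hg(A₁) − dim Hg(A₀ × A₁)
= dim(F₀^{PW₁} ∩ F₁^{PW₀})` with `F₀^{PW₁}` spanned by the matrix coefficients of slot `0` summed over the orbits of the
pointwise stabiliser `PW₁` of slot `1`.  Here `G = Aut(ℂ)`:

* §1 **`forall_smul_eq_iff_forall_mem_normalClosure`** — `PW₁ = Aut(ℂ/L₁)` (an automorphism fixes every embedding of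
  `K_{i₁}` iff it fixes `L₁` pointwise); **`exists_stab_smul_eq_iff_forall_apply_eq`** — THE TRACE DESCRIPTION OF ITS
  ORBITS: `t' ∈ Aut(ℂ/L₁)·t` **iff `t'` and `t` agree on the trace field `t⁻¹(L₁) = {k ∈ K_{i₀} | t(k) ∈ L₁}`** (`⟸`: an
  automorphism moving `t` to `t'` fixes `t(K_{i₀}) ∩ L₁` pointwise, hence lies in `⟨Aut(ℂ/t(K_{i₀})), Aut(ℂ/L₁)⟩` by the
  Galois correspondence for `Aut(ℂ)` (tree `NumberFields/ComplexAutomorphismsFixingIntersection`), and `Aut(ℂ/L₁)` is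
  normal).  The orbits are thus the fibres of `Hom(K_{i₀}, ℂ) → Hom(K_{i₀} ∩ L₁, ℂ)`: the factors of `K_{i₀} ⊗_ℚ L₁`.
* §2 **`cmTypeRank_add_cmTypeRank_eq_cmFamilyRank_add_one_add_finrank_stabOrbitSum_inf`** and its trace form
  **`…_traceSum_inf`** — FOR ANY TWO CM FIELDS AND ANY TWO TYPES:
  **`dim Hg(A₀) + dim Hg(A₁) − dim Hg(A₀ × A₁) = dim(F₀ ∩ F₁)`**, `F₀ = span{ g ↦ Σ_{t : t = a on a⁻¹(L₁)} u₀(g ∘ t) :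
  a ∈ Hom(K_{i₀}, ℂ) }`, `F₁` symmetrically with `L₀`; additive iff `F₀ ∩ F₁ = 0`.  Gen 64 R4's Hecke formula needed a
  Galois pivot INSIDE both fields containing `L₀ ∩ L₁` ((GL)); nothing is needed here (and C3
  `IrreducibleOddWeightsCanonicalPivotInflation` recovers the Hecke form on `L₀ ∩ L₁` itself by inflation).
* §3 TYPE-FREE CONSEQUENCES: **`cmFamilyRank_add_card_eq_pair_of_forall_conj_apply_eq`** — if the trace `a(K_{i₀}) ∩ L₁`
  is REAL for every embedding `a` (e.g. `K_{i₀} ∩ L₁ = ℚ`: `…_of_forall_mem_bot`), then **`Hg(A₀ × A₁) = Hg(A₀) × Hg(A₁)`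
  FOR ALL CM TYPES `Φ₀`, `Φ₁`** (complex conjugation agrees with `a` on the trace, so every `Aut(ℂ/L₁)`-orbit is
  conjugation-stable and C1 applies); then the pair is nondegenerate iff both members are
  (`isNondegenerateFamily_iff_forall_of_forall_conj_apply_eq`), every Hodge class on every `A₀^a × A₁^b` (disjoint slot
  maps) is a sum of exterior products (`forall_hodgeClassesProductSpan_pair_of_forall_conj_apply_eq`), and for
  nondegenerate `Φ₀`, `Φ₁` every `A₀^a × A₁^b` satisfies the Hodge conjecture (`hodgeConjectureFor_prod_of_forall_conj_apply_eq`,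
  the tree's Pohlmann–Gordon theorem for nondegenerate families).  The tree had: linearly disjoint CLOSURES
  (`LinearlyDisjointCMFieldsHodge`), real intersection of CLOSURES (`PartialConjugationOfRealIntersection`), a foreign
  QUADRATIC field (`CMTypeRankForeignQuadraticSlot`), and gen 63 S8's type-dependent balance on point-stabiliser orbits
  (which the real-trace hypothesis implies); the trace `K_{i₀} ∩ L₁` may be real while `L₀ ∩ L₁` is a CM field.

## References

* [Gordon1999HodgeAVSurvey] B. B. Gordon, *A survey of the Hodge conjecture for abelian varieties*, §3 Theorem (Imai,
  Murty) with proof, 7.5–7.7, 9.4.3, 10.10.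
* [MoonenZarhin1999LowDim] B. Moonen, Yu. Zarhin, Math. Ann. 315 (1999), Thm. (0.2), §3 (3.1).
* [Lang2002] S. Lang, *Algebra*, 3rd ed., VI §1 Thm. 1.1, Cor. 1.6, Thm. 1.12 and V §2 Thm. 2.8.
* [Deligne1982HodgeCycles] P. Deligne, *Hodge cycles on abelian varieties*, LNM 900 (1982), I.5 (p. 62), I Ex. 3.7.
* [Shimura1998] G. Shimura, *Abelian Varieties with Complex Multiplication and Modular Functions*, §8.1, §8.3.
-/

set_option autoImplicit false

noncomputable section

open scoped BigOperators Classical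

open CategoryTheory CategoryTheory.Limits NumberField Module IntermediateField

namespace Summit.HodgeConjecture.CorCM

open Literature.NumberTheory.ComplexMultiplication
open Literature.NumberTheory.NumberFields (mem_closure_fixing_union_of_apply_eq)
open Literature.AlgebraicGeometry.Motives (AbelianVariety CMType)
open Literature.AlgebraicGeometry.Motives.AbelianVariety
open Literature.AlgebraicGeometry.HodgeTheory
open Literature.AlgebraicGeometry.ComplexMultiplication (IsCMTypeRealisation)
open Literature.AlgebraicGeometry.Pohlmann1968

/-! ### §1 The pointwise stabiliser of a slot of embeddings and the trace description of its orbits -/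

section Orbits

variable {I : Type} {K : I → Type} [∀ i, Field (K i)] [∀ i, NumberField (K i)]

/-- **`PW₁ = Aut(ℂ/L₁)`**: an automorphism of `ℂ` fixes every complex embedding of `K_{i₁}` iff it fixes the Galois
closure `L₁ = normalClosure ℚ K_{i₁} ℂ` (the compositum of the images of all embeddings) pointwise.
[cite: Lang2002, V §2 Thm. 2.8] [cite: Shimura1998, §8.1] -/
theorem forall_smul_eq_iff_forall_mem_normalClosure (i₁ : I) (n : ℂ ≃+* ℂ) :
    (∀ y : K i₁ →+* ℂ, n • y = y) ↔ ∀ z : ℂ, z ∈ normalClosure ℚ (K i₁) ℂ → n z = z := by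
  constructor
  · intro h z hz
    have h1 := apply_eq_of_forall_smul_eq i₁ (σ := n) (σ' := 1) (fun s => by rw [h s, one_smul]) hz
    rw [h1]
    rfl
  · intro h y
    refine RingHom.ext fun k => ?_
    rw [ringEquiv_smul_apply]
    exact h _ (apply_mem_normalClosure i₁ y k)

/-- **THE TRACE DESCRIPTION OF THE ORBITS OF `Aut(ℂ/L₁)` ON `Hom(K_{i₀}, ℂ)`**: `t'` is an `Aut(ℂ/L₁)`-translate of `t`
**iff `t'` and `t` agree on the trace field `t⁻¹(L₁) = {k ∈ K_{i₀} | t(k) ∈ L₁}`.**  (`⟹` is clear.  `⟸`: an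
automorphism `g` with `g ∘ t = t'` fixes `t(K_{i₀}) ∩ L₁` pointwise, so `g ∈ ⟨Aut(ℂ/t(K_{i₀})), Aut(ℂ/L₁)⟩` by the Galois
correspondence for `Aut(ℂ)`; since `Aut(ℂ/L₁)` is normal and `Aut(ℂ/t(K_{i₀}))` fixes `t`, every element of that
subgroup moves `t` inside `Aut(ℂ/L₁)·t`.)  So the orbits are the fibres of restriction to `K_{i₀} ∩ L₁`, i.e. the
factors of `K_{i₀} ⊗_ℚ L₁`. [cite: Lang2002, VI §1 Thm. 1.1, Cor. 1.6 and V §2 Thm. 2.8] -/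
theorem exists_stab_smul_eq_iff_forall_apply_eq {i₀ : I} (i₁ : I) (t t' : K i₀ →+* ℂ) :
    (∃ n : ℂ ≃+* ℂ, (∀ y : K i₁ →+* ℂ, n • y = y) ∧ n • t = t') ↔
      ∀ k : K i₀, t k ∈ normalClosure ℚ (K i₁) ℂ → t' k = t k := by
  constructor
  · rintro ⟨n, hn, rfl⟩ k hk
    rw [ringEquiv_smul_apply]
    exact (forall_smul_eq_iff_forall_mem_normalClosure i₁ n).1 hn _ hk
  · intro h
    haveI := isPretransitive_ringEquiv_complex (K := K i₀)
    obtain ⟨g, hg⟩ := MulAction.exists_smul_eq (ℂ ≃+* ℂ) t t'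
    haveI : FiniteDimensional ℚ (t.toRatAlgHom).fieldRange :=
      LinearEquiv.finiteDimensional (AlgEquiv.ofInjectiveField t.toRatAlgHom).toLinearEquiv
    -- `g` fixes `t(K_{i₀}) ∩ L₁` pointwise
    have hfix : ∀ x : ℂ, x ∈ (t.toRatAlgHom).fieldRange → x ∈ normalClosure ℚ (K i₁) ℂ → g x = x := by
      intro x hx hx₁
      obtain ⟨k, rfl⟩ := AlgHom.mem_fieldRange.1 hx
      change g (t k) = t k
      have h1 := h k hx₁
      rw [← hg, ringEquiv_smul_apply] at h1
      exact h1
    have hmem := mem_closure_fixing_union_of_apply_eq hfix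
    -- every element of `⟨Aut(ℂ/t(K_{i₀})), Aut(ℂ/L₁)⟩` moves `t` inside `Aut(ℂ/L₁)·t`
    have key : ∀ s ∈ Subgroup.closure
        ({σ : ℂ ≃+* ℂ | ∀ x : ℂ, x ∈ (t.toRatAlgHom).fieldRange → σ x = x} ∪
          {σ : ℂ ≃+* ℂ | ∀ x : ℂ, x ∈ normalClosure ℚ (K i₁) ℂ → σ x = x}),
        ∃ n : ℂ ≃+* ℂ, (∀ y : K i₁ →+* ℂ, n • y = y) ∧ n • t = s • t := by
      intro s hs
      induction hs using Subgroup.closure_induction with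
      | mem s hs =>
        rcases hs with hs | hs
        · refine ⟨1, fun y => one_smul _ y, ?_⟩
          rw [one_smul]
          refine (RingHom.ext fun k => ?_).symm
          rw [ringEquiv_smul_apply]
          exact hs _ (AlgHom.mem_fieldRange.2 ⟨k, rfl⟩)
        · exact ⟨s, (forall_smul_eq_iff_forall_mem_normalClosure i₁ s).2 hs, rfl⟩
      | one => exact ⟨1, fun y => one_smul _ y, rfl⟩
      | mul a b _ _ ha hb =>
        obtain ⟨na, hna, hnat⟩ := ha
        obtain ⟨nb, hnb, hnbt⟩ := hb
        refine ⟨a * nb * a⁻¹ * na, fun y => ?_, ?_⟩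
        · rw [mul_smul, mul_smul, mul_smul, hna, hnb, smul_inv_smul]
        · rw [mul_smul, mul_smul, mul_smul, hnat, inv_smul_smul, hnbt, mul_smul]
      | inv a _ ha =>
        obtain ⟨na, hna, hnat⟩ := ha
        refine ⟨a⁻¹ * na⁻¹ * a, fun y => ?_, ?_⟩
        · rw [mul_smul, mul_smul, inv_smul_eq_iff.2 (hna (a • y)).symm, inv_smul_smul]
        · rw [mul_smul, mul_smul, ← hnat, inv_smul_smul]
    obtain ⟨n, hn, hnt⟩ := key g hmem
    exact ⟨n, hn, hnt.trans hg⟩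

/-- The orbit of `t` under `Aut(ℂ/L₁)`, as a finite set of embeddings, is the set of embeddings agreeing with `t` on the
trace field. [cite: Lang2002, VI §1 Thm. 1.1 and Cor. 1.6] -/
theorem filter_exists_stab_smul_eq_eq_filter_trace {i₀ : I} (i₁ : I) (a : K i₀ →+* ℂ) :
    Finset.univ.filter (fun t : K i₀ →+* ℂ => ∃ n : ℂ ≃+* ℂ, (∀ y : K i₁ →+* ℂ, n • y = y) ∧ n • a = t) =
      Finset.univ.filter (fun t : K i₀ →+* ℂ => ∀ k : K i₀, a k ∈ normalClosure ℚ (K i₁) ℂ → t k = a k) :=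
  Finset.filter_congr fun t _ => exists_stab_smul_eq_iff_forall_apply_eq i₁ a t

/-- The orbit sums of `Aut(ℂ/L₁)` on `Hom(K_{i₀}, ℂ)` are the sums over the trace classes (function form, for
rewriting under binders). [cite: Lang2002, VI §1 Thm. 1.1 and Cor. 1.6] -/
theorem stabOrbitSum_eq_traceSum {i₀ : I} (i₁ : I) (Φ₀ : CMType (K i₀)) :
    (fun a : K i₀ →+* ℂ => fun g : ℂ ≃+* ℂ =>
        ∑ t ∈ Finset.univ.filter
          (fun t : K i₀ →+* ℂ => ∃ n : ℂ ≃+* ℂ, (∀ y : K i₁ →+* ℂ, n • y = y) ∧ n • a = t), antiVec Φ₀.1 g t) =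
      fun a : K i₀ →+* ℂ => fun g : ℂ ≃+* ℂ =>
        ∑ t ∈ Finset.univ.filter
          (fun t : K i₀ →+* ℂ => ∀ k : K i₀, a k ∈ normalClosure ℚ (K i₁) ℂ → t k = a k), antiVec Φ₀.1 g t := by
  funext a g
  rw [filter_exists_stab_smul_eq_eq_filter_trace]

/-- **A real trace makes every orbit conjugation-stable**: if `a(k)` is real for every `k` with `a(k) ∈ L₁`, then
`ā ∈ Aut(ℂ/L₁)·a`. [cite: Lang2002, VI §1 Cor. 1.6] [cite: Shimura1998, §8.3] -/
theorem exists_stab_smul_eq_conj_of_forall_conj_apply_eq {i₀ : I} (i₁ : I) (a : K i₀ →+* ℂ)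
    (hreal : ∀ k : K i₀, a k ∈ normalClosure ℚ (K i₁) ℂ → starRingEnd ℂ (a k) = a k) :
    ∃ n : ℂ ≃+* ℂ, (∀ y : K i₁ →+* ℂ, n • y = y) ∧ n • a = (starRingAut : ℂ ≃+* ℂ) • a :=
  (exists_stab_smul_eq_iff_forall_apply_eq i₁ a _).2 fun k hk => by
    rw [ringEquiv_smul_apply, starRingAut_apply, ← starRingEnd_apply, hreal k hk]

end Orbits

/-! ### §2 The exact defect for any two CM fields -/

section Rank

variable {I : Type} [Fintype I] {K : I → Type} [∀ i, Field (K i)] [∀ i, NumberField (K i)] [∀ i, IsCMField (K i)]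

/-- **THE EXACT DEFECT FOR ANY TWO CM FIELDS AND ANY TWO TYPES (orbit form)**:
`cmTypeRank Φ₀ + cmTypeRank Φ₁ = cmFamilyRank Φ + 1 + dim(F₀ ∩ F₁)`, i.e.
**`dim Hg(A₀) + dim Hg(A₁) − dim Hg(A₀ × A₁) = dim(F₀ ∩ F₁)`**, where `F₀ ≤ ℚ^{Aut(ℂ)}` is spanned by the functions
`g ↦ Σ_{t ∈ Aut(ℂ/L₁)·a} u₀(g ∘ t)` (`a ∈ Hom(K_{i₀}, ℂ)`; the matrix coefficients of slot `0` summed over the orbits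
of the automorphisms fixing every embedding of `K_{i₁}`) and `F₁` symmetrically.  NO hypothesis.
[cite: Gordon1999HodgeAVSurvey, §3 Theorem and 7.5–7.7] [cite: Deligne1982HodgeCycles, I.5 (p. 62)] -/
theorem cmTypeRank_add_cmTypeRank_eq_cmFamilyRank_add_one_add_finrank_stabOrbitSum_inf {i₀ i₁ : I} (h01 : i₀ ≠ i₁)
    (hI : ∀ l, l = i₀ ∨ l = i₁) (Φ : ∀ i, CMType (K i)) :
    cmTypeRank (Φ i₀) + cmTypeRank (Φ i₁) = CMAlgebra.cmFamilyRank Φ + 1 +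
      Module.finrank ℚ (Submodule.span ℚ (Set.range fun a : K i₀ →+* ℂ => fun g : ℂ ≃+* ℂ =>
            ∑ t ∈ Finset.univ.filter
              (fun t : K i₀ →+* ℂ => ∃ n : ℂ ≃+* ℂ, (∀ y : K i₁ →+* ℂ, n • y = y) ∧ n • a = t),
                antiVec (Φ i₀).1 g t) ⊓
          Submodule.span ℚ (Set.range fun a : K i₁ →+* ℂ => fun g : ℂ ≃+* ℂ =>
            ∑ t ∈ Finset.univ.filter
              (fun t : K i₁ →+* ℂ => ∃ n : ℂ ≃+* ℂ, (∀ y : K i₀ →+* ℂ, n • y = y) ∧ n • a = t),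
                antiVec (Φ i₁).1 g t) : Submodule ℚ ((ℂ ≃+* ℂ) → ℚ)) := by
  haveI : ∀ i, Nonempty (K i →+* ℂ) := fun i => inferInstance
  exact IrrOdd.typeRank_add_typeRank_eq_add_finrank_stabOrbitSum_inf (G := ℂ ≃+* ℂ) (E := fun i => K i →+* ℂ)
    (Φ := fun i => (Φ i).1) (fun i => isCMTypeWith_conj (Φ i)) hI h01

/-- **THE EXACT DEFECT, TRACE FORM** — the orbit sums written over the classes of embeddings of `K_{i₀}` AGREEING ON THE
TRACE `a⁻¹(L₁)` (resp. of `K_{i₁}` agreeing on the trace of `L₀`): a finite computation from the two fields and types,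
**`dim Hg(A₀) + dim Hg(A₁) − dim Hg(A₀ × A₁) = dim(F₀ ∩ F₁)`**,
`F₀ = span{ g ↦ Σ_{t : t = a on a⁻¹(L₁)} u₀(g ∘ t) }`. [cite: Gordon1999HodgeAVSurvey, §3 Theorem and 7.5–7.7]
[cite: Lang2002, VI §1 Thm. 1.1 and Cor. 1.6] -/
theorem cmTypeRank_add_cmTypeRank_eq_cmFamilyRank_add_one_add_finrank_traceSum_inf {i₀ i₁ : I} (h01 : i₀ ≠ i₁)
    (hI : ∀ l, l = i₀ ∨ l = i₁) (Φ : ∀ i, CMType (K i)) :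
    cmTypeRank (Φ i₀) + cmTypeRank (Φ i₁) = CMAlgebra.cmFamilyRank Φ + 1 +
      Module.finrank ℚ (Submodule.span ℚ (Set.range fun a : K i₀ →+* ℂ => fun g : ℂ ≃+* ℂ =>
            ∑ t ∈ Finset.univ.filter
              (fun t : K i₀ →+* ℂ => ∀ k : K i₀, a k ∈ normalClosure ℚ (K i₁) ℂ → t k = a k),
                antiVec (Φ i₀).1 g t) ⊓
          Submodule.span ℚ (Set.range fun a : K i₁ →+* ℂ => fun g : ℂ ≃+* ℂ =>
            ∑ t ∈ Finset.univ.filter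
              (fun t : K i₁ →+* ℂ => ∀ k : K i₁, a k ∈ normalClosure ℚ (K i₀) ℂ → t k = a k),
                antiVec (Φ i₁).1 g t) : Submodule ℚ ((ℂ ≃+* ℂ) → ℚ)) := by
  have h := cmTypeRank_add_cmTypeRank_eq_cmFamilyRank_add_one_add_finrank_stabOrbitSum_inf h01 hI Φ
  rw [stabOrbitSum_eq_traceSum i₁ (Φ i₀), stabOrbitSum_eq_traceSum i₀ (Φ i₁)] at h
  exact h

/-- **`Hg(A₀ × A₁) = Hg(A₀) × Hg(A₁)` IFF `F₀ ∩ F₁ = 0`** (trace form), for any two CM fields and types.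
[cite: Gordon1999HodgeAVSurvey, §3 Theorem and 7.5–7.7] -/
theorem cmFamilyRank_add_card_eq_pair_iff_traceSum_inf_eq_bot {i₀ i₁ : I} (h01 : i₀ ≠ i₁)
    (hI : ∀ l, l = i₀ ∨ l = i₁) (Φ : ∀ i, CMType (K i)) :
    CMAlgebra.cmFamilyRank Φ + Fintype.card I = (∑ i, cmTypeRank (Φ i)) + 1 ↔
      Submodule.span ℚ (Set.range fun a : K i₀ →+* ℂ => fun g : ℂ ≃+* ℂ =>
            ∑ t ∈ Finset.univ.filter
              (fun t : K i₀ →+* ℂ => ∀ k : K i₀, a k ∈ normalClosure ℚ (K i₁) ℂ → t k = a k),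
                antiVec (Φ i₀).1 g t) ⊓
          Submodule.span ℚ (Set.range fun a : K i₁ →+* ℂ => fun g : ℂ ≃+* ℂ =>
            ∑ t ∈ Finset.univ.filter
              (fun t : K i₁ →+* ℂ => ∀ k : K i₁, a k ∈ normalClosure ℚ (K i₀) ℂ → t k = a k),
                antiVec (Φ i₁).1 g t) = (⊥ : Submodule ℚ ((ℂ ≃+* ℂ) → ℚ)) := by
  haveI : ∀ i, Nonempty (K i →+* ℂ) := fun i => inferInstance
  have h := IrrOdd.typeRank_sigmaType_add_card_eq_iff_stabOrbitSum_inf_eq_bot (G := ℂ ≃+* ℂ)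
    (E := fun i => K i →+* ℂ) (Φ := fun i => (Φ i).1) (fun i => isCMTypeWith_conj (Φ i)) hI h01
  rw [stabOrbitSum_eq_traceSum i₁ (Φ i₀), stabOrbitSum_eq_traceSum i₀ (Φ i₁)] at h
  exact h

/-! ### §3 Type-free consequences: a real trace -/

/-- **A REAL TRACE FORCES `Hg(A₀ × A₁) = Hg(A₀) × Hg(A₁)` FOR ALL TYPES.**  If for every embedding `a` of `K_{i₀}` the
elements of `a(K_{i₀}) ∩ L₁` are real (`L₁` the Galois closure of `K_{i₁}` in `ℂ`; e.g. `K_{i₀}` meets `L₁` trivially, or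
in a totally real field), then `cmFamilyRank Φ + 2 = cmTypeRank Φ₀ + cmTypeRank Φ₁ + 1` for EVERY pair of CM types: every
`Aut(ℂ/L₁)`-orbit on `Hom(K_{i₀}, ℂ)` is conjugation-stable, so its orbit sums vanish (C1).
[cite: Gordon1999HodgeAVSurvey, §3 Theorem (proof) and 7.5–7.7] [cite: MoonenZarhin1999LowDim, Thm. (0.2)] -/
theorem cmFamilyRank_add_card_eq_pair_of_forall_conj_apply_eq {i₀ i₁ : I} (h01 : i₀ ≠ i₁) (hI : ∀ l, l = i₀ ∨ l = i₁)
    (Φ : ∀ i, CMType (K i))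
    (hreal : ∀ (a : K i₀ →+* ℂ) (k : K i₀), a k ∈ normalClosure ℚ (K i₁) ℂ → starRingEnd ℂ (a k) = a k) :
    CMAlgebra.cmFamilyRank Φ + Fintype.card I = (∑ i, cmTypeRank (Φ i)) + 1 := by
  haveI : ∀ i, Nonempty (K i →+* ℂ) := fun i => inferInstance
  exact IrrOdd.typeRank_sigmaType_add_card_eq_of_stabOrbit_rho_stable (G := ℂ ≃+* ℂ) (E := fun i => K i →+* ℂ)
    (Φ := fun i => (Φ i).1) (fun i => isCMTypeWith_conj (Φ i)) hI h01
    fun a => exists_stab_smul_eq_conj_of_forall_conj_apply_eq i₁ a (hreal a)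

/-- **A TRIVIAL TRACE** (`a(K_{i₀}) ∩ L₁ = ℚ` for every embedding `a`, i.e. `K_{i₀} ⊗_ℚ L₁` is a field) forces
`Hg(A₀ × A₁) = Hg(A₀) × Hg(A₁)` for all types — the Galois closure `L₀` of `K_{i₀}` may well meet `L₁` in a CM field.
[cite: Gordon1999HodgeAVSurvey, §3 Theorem (proof) and 7.5–7.7] [cite: Lang2002, VI §1 Thm. 1.12] -/
theorem cmFamilyRank_add_card_eq_pair_of_forall_mem_bot {i₀ i₁ : I} (h01 : i₀ ≠ i₁) (hI : ∀ l, l = i₀ ∨ l = i₁)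
    (Φ : ∀ i, CMType (K i))
    (hbot : ∀ (a : K i₀ →+* ℂ) (k : K i₀), a k ∈ normalClosure ℚ (K i₁) ℂ → a k ∈ (⊥ : IntermediateField ℚ ℂ)) :
    CMAlgebra.cmFamilyRank Φ + Fintype.card I = (∑ i, cmTypeRank (Φ i)) + 1 := by
  refine cmFamilyRank_add_card_eq_pair_of_forall_conj_apply_eq h01 hI Φ fun a k hk => ?_
  obtain ⟨q, hq⟩ := IntermediateField.mem_bot.1 (hbot a k hk)
  rw [← hq, eq_ratCast, map_ratCast]

/-- **… then the pair is nondegenerate iff both members are.** [cite: Gordon1999HodgeAVSurvey, 7.5–7.6.1] -/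
theorem isNondegenerateFamily_iff_forall_of_forall_conj_apply_eq {i₀ i₁ : I} (h01 : i₀ ≠ i₁)
    (hI : ∀ l, l = i₀ ∨ l = i₁) (Φ : ∀ i, CMType (K i))
    (hreal : ∀ (a : K i₀ →+* ℂ) (k : K i₀), a k ∈ normalClosure ℚ (K i₁) ℂ → starRingEnd ℂ (a k) = a k) :
    CMAlgebra.IsNondegenerateFamily Φ ↔ ∀ i, IsNondegenerate (Φ i) := by
  haveI : Nonempty I := ⟨i₀⟩
  exact isNondegenerateFamily_iff_forall_of_cmFamilyRank_add_card_eq Φ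
    (cmFamilyRank_add_card_eq_pair_of_forall_conj_apply_eq h01 hI Φ hreal)

variable {Φ : ∀ i, CMType (K i)} {A : I → AbelianVariety ℂ} {ιA : ∀ i, 𝓞 (K i) →+* End (A i)}
  {θ : ∀ i, K i →+* Module.End ℂ (complexBetti (A i).X 1)}

/-- **… and then every rational Hodge class on every `A₀^a × A₁^b` (disjoint slot maps) is a `ℂ`-combination of exterior
products of rational Hodge classes of the factors**: NO MIXED exceptional classes, whatever the types.
[cite: MoonenZarhin1999LowDim, §3 (3.1)] [cite: Gordon1999HodgeAVSurvey, 7.5–7.7] -/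
theorem forall_hodgeClassesProductSpan_pair_of_forall_conj_apply_eq {i₀ i₁ : I} (h01 : i₀ ≠ i₁)
    (hI : ∀ l, l = i₀ ∨ l = i₁)
    (hreal : ∀ (a : K i₀ →+* ℂ) (k : K i₀), a k ∈ normalClosure ℚ (K i₁) ℂ → starRingEnd ℂ (a k) = a k)
    (hA : ∀ i, IsCMTypeRealisation (Φ i) (A i) (ιA i) (θ i)) (N₁ N₂ : ℕ) [NeZero N₁] [NeZero N₂] (π₁ : Fin N₁ → I)
    (π₂ : Fin N₂ → I) (hdisj : ∀ l₁ l₂, π₁ l₁ ≠ π₂ l₂) :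
    HodgeClassesProductSpan (⨁ fun l => A (π₁ l)) (⨁ fun l => A (π₂ l)) := by
  haveI : Nonempty I := ⟨i₀⟩
  exact (cmFamilyRank_add_card_eq_iff_forall_hodgeClassesProductSpan hA).1
    (cmFamilyRank_add_card_eq_pair_of_forall_conj_apply_eq h01 hI Φ hreal) N₁ N₂ π₁ π₂ hdisj

/-- **… and for NONDEGENERATE `Φ₀`, `Φ₁` every product `⨁_l A_{π l}` (every `A₀^a × A₁^b`) satisfies the Hodge
conjecture, unconditionally** — the family is nondegenerate, and nondegenerate families are covered by the tree's
Pohlmann–Gordon theorem (`B• = D•` on all products of powers). [cite: Gordon1999HodgeAVSurvey, 10.10 and 7.5]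
[cite: MoonenZarhin1999LowDim, Thm. (0.2)] -/
theorem hodgeConjectureFor_prod_of_forall_conj_apply_eq {i₀ i₁ : I} (h01 : i₀ ≠ i₁) (hI : ∀ l, l = i₀ ∨ l = i₁)
    (hreal : ∀ (a : K i₀ →+* ℂ) (k : K i₀), a k ∈ normalClosure ℚ (K i₁) ℂ → starRingEnd ℂ (a k) = a k)
    (hnd : ∀ i, IsNondegenerate (Φ i)) (hA : ∀ i, IsCMTypeRealisation (Φ i) (A i) (ιA i) (θ i)) {N : ℕ}
    (π : Fin N → I) :
    HodgeConjectureFor (⨁ fun l : Fin N => A (π l)).dim (⨁ fun l : Fin N => A (π l)).X := by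
  haveI : Nonempty I := ⟨i₀⟩
  exact ((isNondegenerateFamily_iff_forall_of_forall_conj_apply_eq h01 hI Φ hreal).2 hnd).hodgeConjectureFor_prod hA π

end Rank

end Summit.HodgeConjecture.CorCM

end
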